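import Summits.HodgeConjecture.CorCM.IrreducibleOddWeightsDichotomy
import HarnessLib

/-!
# Orbit spans and evaluation spaces in the permutation module `ℚ^X`: the tools for Mai's multiplicity formula

COR-CM (cell `pub-hodgecm2`, binder seat `b16` gen 57, count-neutral claim MULTIPLICITY, file F1 — abstract `G`-set
level; theorems only, no definition, no named fact, no `sorry`).  NEW as stated, hence under `Summits/`.  HONEST
FRAMING: finite-dimensional linear algebra over `ℚ` (a group `G` permuting a finite set `X`, the permutation module
`ℚ^X` with `(g·f)(x) = f(g⁻¹x)`), feeding the rank of (families of) CM types = `dim` of Mumford–Tate groups of (products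
of) abelian varieties with complex multiplication; no hypothesis on `G` or `X`; `HC_CM` is neither used nor asserted.

NOTATION (local, no definition is introduced).  For `w ∈ ℚ^X`, the ORBIT SPAN `𝒪[G, w] = span_ℚ{x ↦ w(gx) : g ∈ G}`
(the cyclic `G`-submodule generated by `w`; for a type `Φ ⊆ X` and `w = u_1(Φ)` this is Shimura's antisymmetric span
`U(Φ) = antiSpan G Φ`, `orbitSpan_antiVec_one`).  For a representation `(π, V)` of `G` over `ℚ`, the EVALUATION SPACE
`Ev[G, π, w] = {T(w) : T : ℚ^X → V linear, G-equivariant} ≤ V` (equivariant: `T(g·f) = π(g) T(f)`) — for `E = G/H`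
and `w = u_1(Φ)` the column space of Mai's matrix `π(τ)` on the `H`-invariants.

* §1 `mem_evalSpace_iff` (the set of evaluations is already a subspace), `orbitSpan_stable`, `orbitSpan_le`,
  `apply_eq_zero_of_mem_orbitSpan` (an equivariant map killing `w` kills `𝒪[G, w]`), `orbitSpan_eq_bot_iff`,
  `orbitSpan_antiVec_one` (`𝒪[G, u_1(Φ)] = U(Φ)`), `evalSpace_eq_bot_of_eq_zero`.
* §2 THE IRREDUCIBLE PIECE.  `P ≤ ℚ^X` stable and irreducible, `p ∈ P` non-zero (so `𝒪[G, p] = P`,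
  `orbitSpan_eq_of_irreducible`), `(π, V)` irreducible met by `P` (some equivariant `T₀ : ℚ^X → V` does not kill `P`,
  hence `T₀|_P : P ≅ V`, `finrank_eq_of_irreducible_of_not_forall`): **`finrank_evalSpace_eq_of_irreducible`** —
  `dim Ev[G, π, p] = dim End_G(V)` (`S ↦ S(T₀ p)` is a linear isomorphism `End_G(V) ≅ Ev[G, π, p]`), and
  **`evalSpace_eq_bot_of_forall_intertwiningMap_eq_zero`** — `Ev[G, π', p] = 0` for every representation `π'`
  admitting no non-zero intertwiner from `π` (Schur).

Sequels: F2 `CorCM/IrreducibleOddWeightsEvaluationSplitting` (the splitting step along the equivariant projection onto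
a stable `P ≤ 𝒪[G, w]`), F3 `CorCM/IrreducibleOddWeightsMultiplicity` (the formula `dim 𝒪[G, w] =
Σ_π (dim V_π / dim End_G V_π) · dim Ev[G, π, w]` by induction on `dim 𝒪[G, w]`), then families of CM types,
transitive slots, CM fields.

## References

* [Mai1989] L. Mai, *Lower bounds for the ranks of CM types*, J. Number Theory 32 (1989), §2 Prop. 1 (proof:
  "`rank(K, S) = rank(reg(τ)) = Σ_π d_π rank(π(τ))`").
* [Serre1977] J.-P. Serre, *Linear Representations of Finite Groups*, GTM 42 (1977), §1.3 Thm. 1, §2.2 Prop. 4.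
* [Kubota1965] T. Kubota, *On the field extension by complex multiplication*, Trans. AMS 118 (1965), Lemma 2.
* [Deligne1982HodgeCycles] P. Deligne, *Hodge cycles on abelian varieties*, LNM 900 (1982), I Ex. 3.7 (c).
-/

set_option autoImplicit false

noncomputable section

open scoped BigOperators

universe u u' v w

namespace Summit.HodgeConjecture.CorCM.IrrOdd

open Literature.NumberTheory.ComplexMultiplication

variable {G : Type w} [Group G] {X : Type v} [MulAction G X]

/-- The orbit span `𝒪[G, w] = span_ℚ {x ↦ w (g • x) : g ∈ G}` (local notation, no definition). -/
local notation3 (prettyPrint := false) "𝒪[" G' ", " w "]" =>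
  Submodule.span ℚ (Set.range fun g : G' => fun x => w (g • x))

/-- The evaluation space `Ev[G, π, w] = {T w : T equivariant}` (local notation, no definition). -/
local notation3 (prettyPrint := false) "Ev[" G' ", " π ", " w "]" =>
  Submodule.span ℚ {v | ∃ T : (_ → ℚ) →ₗ[ℚ] _,
    (∀ (g : G') (f : _ → ℚ), T (fun x => f (g⁻¹ • x)) = π g (T f)) ∧ T w = v}

/-! ### §1 Orbit spans and evaluation spaces -/

section Basic

variable {V : Type*} [AddCommGroup V] [Module ℚ V]

/-- **The evaluations `T(w)` of the equivariant maps already form a subspace**: `v ∈ Ev[G, π, w]` iff `v = T(w)` for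
some equivariant `T : ℚ^X → V`. [cite: Mai1989, §2 Prop. 1 (proof)] -/
theorem mem_evalSpace_iff (π : Representation ℚ G V) (w : X → ℚ) (v : V) :
    v ∈ Ev[G, π, w] ↔ ∃ T : (X → ℚ) →ₗ[ℚ] V,
      (∀ (g : G) (f : X → ℚ), T (fun x => f (g⁻¹ • x)) = π g (T f)) ∧ T w = v := by
  constructor
  · intro hv
    refine Submodule.span_induction (fun _ h => h) ⟨0, fun g f => by simp, rfl⟩
      (fun a b _ _ ha hb => ?_) (fun c a _ ha => ?_) hv
    · obtain ⟨T₁, hT₁, rfl⟩ := ha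
      obtain ⟨T₂, hT₂, rfl⟩ := hb
      exact ⟨T₁ + T₂, fun g f => by rw [LinearMap.add_apply, LinearMap.add_apply, hT₁, hT₂, map_add], rfl⟩
    · obtain ⟨T, hT, rfl⟩ := ha
      exact ⟨c • T, fun g f => by rw [LinearMap.smul_apply, LinearMap.smul_apply, hT, map_smul], rfl⟩
  · intro hv
    exact Submodule.subset_span hv

/-- `Ev[G, π, w] ≤ V'` as soon as every evaluation lies in the subspace `V'`. [folklore] -/
theorem evalSpace_le_iff (π : Representation ℚ G V) (w : X → ℚ) (V' : Submodule ℚ V) :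
    Ev[G, π, w] ≤ V' ↔ ∀ T : (X → ℚ) →ₗ[ℚ] V,
      (∀ (g : G) (f : X → ℚ), T (fun x => f (g⁻¹ • x)) = π g (T f)) → T w ∈ V' := by
  rw [Submodule.span_le]
  constructor
  · intro h T hT
    exact h ⟨T, hT, rfl⟩
  · rintro h _ ⟨T, hT, rfl⟩
    exact h T hT

/-- `Ev[G, π, 0] = 0`. [folklore] -/
theorem evalSpace_eq_bot_of_eq_zero (π : Representation ℚ G V) : Ev[G, π, (0 : X → ℚ)] = ⊥ := by
  rw [eq_bot_iff, evalSpace_le_iff]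
  intro T _
  rw [map_zero]
  exact Submodule.zero_mem _

/-- `w ∈ 𝒪[G, w]`. [folklore] -/
theorem mem_orbitSpan_self (w : X → ℚ) : w ∈ 𝒪[G, w] :=
  Submodule.subset_span ⟨1, funext fun x => by simp only [one_smul]⟩

/-- **`𝒪[G, w]` is `G`-stable.** [cite: Serre1977, §1.3] -/
theorem orbitSpan_stable (w : X → ℚ) (k : G) (f : X → ℚ) (hf : f ∈ 𝒪[G, w]) :
    (fun x => f (k • x)) ∈ 𝒪[G, w] := by
  refine Submodule.span_induction ?_ ?_ (fun a b _ _ ha hb => ?_) (fun c a _ ha => ?_) hf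
  · rintro _ ⟨g, rfl⟩
    refine Submodule.subset_span ⟨g * k, ?_⟩
    funext x
    simp only [mul_smul]
  · exact Submodule.zero_mem _
  · exact Submodule.add_mem _ ha hb
  · exact Submodule.smul_mem _ c ha

/-- **`𝒪[G, w] ≤ W` for every stable `W ∋ w`** (the orbit span is the stable subspace generated by `w`).
[cite: Serre1977, §1.3] -/
theorem orbitSpan_le {W : Submodule ℚ (X → ℚ)}
    (hWst : ∀ (k : G) (f : X → ℚ), f ∈ W → (fun x => f (k • x)) ∈ W) {w : X → ℚ} (hw : w ∈ W) :
    𝒪[G, w] ≤ W := by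
  refine Submodule.span_le.2 ?_
  rintro _ ⟨g, rfl⟩
  exact hWst g w hw

/-- Orbit spans are monotone under membership: `w' ∈ 𝒪[G, w] ⟹ 𝒪[G, w'] ≤ 𝒪[G, w]`. [cite: Serre1977, §1.3] -/
theorem orbitSpan_le_orbitSpan {w w' : X → ℚ} (hw' : w' ∈ 𝒪[G, w]) : 𝒪[G, w'] ≤ 𝒪[G, w] :=
  orbitSpan_le (orbitSpan_stable w) hw'

/-- **An equivariant map killing `w` kills `𝒪[G, w]`.** [cite: Mai1989, §2 Prop. 1 (proof)] -/
theorem apply_eq_zero_of_mem_orbitSpan (π : Representation ℚ G V) (T : (X → ℚ) →ₗ[ℚ] V)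
    (hT : ∀ (g : G) (f : X → ℚ), T (fun x => f (g⁻¹ • x)) = π g (T f)) {w : X → ℚ} (hTw : T w = 0)
    {f : X → ℚ} (hf : f ∈ 𝒪[G, w]) : T f = 0 := by
  have hle : 𝒪[G, w] ≤ LinearMap.ker T := by
    refine Submodule.span_le.2 ?_
    rintro _ ⟨g, rfl⟩
    rw [SetLike.mem_coe, LinearMap.mem_ker]
    have h := hT g⁻¹ w
    rw [inv_inv] at h
    rw [h, hTw, map_zero]
  exact hle hf

/-- `𝒪[G, w] = 0 ⟺ w = 0`. [folklore] -/
theorem orbitSpan_eq_bot_iff (w : X → ℚ) : 𝒪[G, w] = ⊥ ↔ w = 0 := by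
  constructor
  · intro h
    have hw := mem_orbitSpan_self (G := G) w
    rw [h, Submodule.mem_bot] at hw
    exact hw
  · rintro rfl
    rw [eq_bot_iff]
    refine Submodule.span_le.2 ?_
    rintro _ ⟨g, rfl⟩
    exact Submodule.zero_mem _

/-- **`𝒪[G, u_1(Φ)] = U(Φ)`**: the orbit span of the type vector is Shimura's antisymmetric span (`u_g = x ↦ u_1(gx)`).
[cite: Shimura1998, §32.10] -/
theorem orbitSpan_antiVec_one (Φ : Set X) : 𝒪[G, antiVec Φ (1 : G)] = antiSpan G Φ := by
  rw [antiSpan]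
  congr 1
  ext f
  constructor
  · rintro ⟨g, rfl⟩
    refine ⟨g, ?_⟩
    show antiVec Φ g = fun x => antiVec Φ (1 : G) (g • x)
    rw [antiVec_eq_antiVec_one_comp_smul Φ g, inv_inv]
  · rintro ⟨g, rfl⟩
    refine ⟨g, ?_⟩
    show (fun x => antiVec Φ (1 : G) (g • x)) = antiVec Φ g
    rw [antiVec_eq_antiVec_one_comp_smul Φ g, inv_inv]

/-- Precomposition with an equivariant endomorphism of `ℚ^X` keeps a map equivariant. [folklore] -/
theorem equivariant_comp (π : Representation ℚ G V) (T : (X → ℚ) →ₗ[ℚ] V)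
    (hT : ∀ (g : G) (f : X → ℚ), T (fun x => f (g⁻¹ • x)) = π g (T f))
    (Q : (X → ℚ) →ₗ[ℚ] (X → ℚ)) (hQ : ∀ (g : G) (f : X → ℚ), Q (fun x => f (g⁻¹ • x)) = fun x => Q f (g⁻¹ • x))
    (g : G) (f : X → ℚ) : (T ∘ₗ Q) (fun x => f (g⁻¹ • x)) = π g ((T ∘ₗ Q) f) := by
  rw [LinearMap.comp_apply, LinearMap.comp_apply, hQ, hT]

end Basic

/-! ### §2 The irreducible piece: `dim Ev = dim End_G(V)` on the matching irreducible, `0` elsewhere -/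

section Irreducible

variable {V : Type*} [AddCommGroup V] [Module ℚ V]

/-- **`𝒪[G, p] = P` for a non-zero vector of an irreducible stable `P`.** [cite: Serre1977, §2.2 Prop. 4] -/
theorem orbitSpan_eq_of_irreducible {P : Submodule ℚ (X → ℚ)}
    (hPst : ∀ (k : G) (a : X → ℚ), a ∈ P → (fun x => a (k • x)) ∈ P)
    (hirr : ∀ W : Submodule ℚ (X → ℚ), W ≤ P → W ≠ ⊥ →
      (∀ (k : G) (f : X → ℚ), f ∈ W → (fun y => f (k • y)) ∈ W) → W = P)
    {p : X → ℚ} (hp : p ∈ P) (hp0 : p ≠ 0) : 𝒪[G, p] = P :=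
  hirr _ (orbitSpan_le hPst hp) (fun h => hp0 ((orbitSpan_eq_bot_iff (G := G) p).1 h)) (orbitSpan_stable p)

/-- **An irreducible stable `P ≤ ℚ^X` met by an irreducible `(π, V)` has `dim P = dim V`** (`T₀|_P : P ≅ V` for any
equivariant `T₀` not killing `P`). [cite: Serre1977, §2.2 Prop. 4] -/
theorem finrank_eq_of_irreducible_of_not_forall [Fintype X] [FiniteDimensional ℚ V] {P : Submodule ℚ (X → ℚ)}
    (hPst : ∀ (k : G) (a : X → ℚ), a ∈ P → (fun x => a (k • x)) ∈ P)
    (hirr : ∀ W : Submodule ℚ (X → ℚ), W ≤ P → W ≠ ⊥ →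
      (∀ (k : G) (f : X → ℚ), f ∈ W → (fun y => f (k • y)) ∈ W) → W = P)
    (π : Representation ℚ G V) (hπ : π.IsIrreducible)
    (T₀ : (X → ℚ) →ₗ[ℚ] V) (hT₀ : ∀ (g : G) (f : X → ℚ), T₀ (fun x => f (g⁻¹ • x)) = π g (T₀ f))
    (hT₀P : ¬ ∀ a ∈ P, T₀ a = 0) : Module.finrank ℚ P = Module.finrank ℚ V := by
  have hinj := injOn_of_irreducible hPst hirr π T₀ hT₀ hT₀P
  have hsurj : P.map T₀ = ⊤ := by
    let S : Subrepresentation π := ⟨P.map T₀, fun g v hv => by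
      obtain ⟨a, ha, rfl⟩ := hv
      exact ⟨fun x => a (g⁻¹ • x), hPst g⁻¹ a ha, hT₀ g a⟩⟩
    rcases hπ.eq_bot_or_eq_top S with hS | hS
    · exfalso
      apply hT₀P
      intro a ha
      have hmem : T₀ a ∈ (S : Subrepresentation π).toSubmodule := ⟨a, ha, rfl⟩
      rw [hS] at hmem
      exact (Submodule.mem_bot ℚ).1 hmem
    · exact congrArg Subrepresentation.toSubmodule hS
  have hker : LinearMap.ker (T₀.domRestrict P) = ⊥ := by
    rw [LinearMap.ker_eq_bot']
    intro a ha
    exact Subtype.ext (hinj _ a.2 ha)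
  have hrange : LinearMap.range (T₀.domRestrict P) = ⊤ := by
    rw [LinearMap.range_domRestrict, hsurj]
  have h := LinearMap.finrank_range_add_finrank_ker (T₀.domRestrict P)
  rw [hker, finrank_bot, add_zero, hrange, finrank_top] at h
  exact h.symm

/-- The equivariant isomorphism `e = T₀|_P : P ≅ V` and the equivariance of its inverse (internal tool).
[cite: Serre1977, §2.2 Prop. 4] -/
theorem exists_linearEquiv_of_irreducible {P : Submodule ℚ (X → ℚ)}
    (hPst : ∀ (k : G) (a : X → ℚ), a ∈ P → (fun x => a (k • x)) ∈ P)
    (hirr : ∀ W : Submodule ℚ (X → ℚ), W ≤ P → W ≠ ⊥ →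
      (∀ (k : G) (f : X → ℚ), f ∈ W → (fun y => f (k • y)) ∈ W) → W = P)
    (π : Representation ℚ G V) (hπ : π.IsIrreducible)
    (T₀ : (X → ℚ) →ₗ[ℚ] V) (hT₀ : ∀ (g : G) (f : X → ℚ), T₀ (fun x => f (g⁻¹ • x)) = π g (T₀ f))
    (hT₀P : ¬ ∀ a ∈ P, T₀ a = 0) :
    ∃ e : P ≃ₗ[ℚ] V, (∀ a : P, e a = T₀ a) ∧
      ∀ (g : G) (v : V), (e.symm (π g v) : X → ℚ) = fun x => (e.symm v : X → ℚ) (g⁻¹ • x) := by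
  have hinj := injOn_of_irreducible hPst hirr π T₀ hT₀ hT₀P
  have hsurj : P.map T₀ = ⊤ := by
    let S : Subrepresentation π := ⟨P.map T₀, fun g v hv => by
      obtain ⟨a, ha, rfl⟩ := hv
      exact ⟨fun x => a (g⁻¹ • x), hPst g⁻¹ a ha, hT₀ g a⟩⟩
    rcases hπ.eq_bot_or_eq_top S with hS | hS
    · exfalso
      apply hT₀P
      intro a ha
      have hmem : T₀ a ∈ (S : Subrepresentation π).toSubmodule := ⟨a, ha, rfl⟩
      rw [hS] at hmem
      exact (Submodule.mem_bot ℚ).1 hmem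
    · exact congrArg Subrepresentation.toSubmodule hS
  have hbij : Function.Bijective (T₀.domRestrict P) := by
    refine ⟨fun a b hab => Subtype.ext ?_, fun v => ?_⟩
    · have h : T₀ (a - b : P) = 0 := by
        rw [Submodule.coe_sub, map_sub]
        exact sub_eq_zero.2 hab
      exact sub_eq_zero.1 (hinj _ (a - b).2 h)
    · have hv : v ∈ P.map T₀ := hsurj ▸ Submodule.mem_top
      obtain ⟨a, ha, rfl⟩ := hv
      exact ⟨⟨a, ha⟩, rfl⟩
  let e : P ≃ₗ[ℚ] V := LinearEquiv.ofBijective (T₀.domRestrict P) hbij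
  have he : ∀ a : P, e a = T₀ a := fun a => rfl
  refine ⟨e, he, fun g v => ?_⟩
  have h1 : e ⟨fun x => (e.symm v : X → ℚ) (g⁻¹ • x), hPst g⁻¹ _ (e.symm v).2⟩ = π g v := by
    rw [he]
    change T₀ (fun x => (e.symm v : X → ℚ) (g⁻¹ • x)) = π g v
    rw [hT₀ g, ← he, LinearEquiv.apply_symm_apply]
  have h2 := congrArg e.symm h1
  rw [LinearEquiv.symm_apply_apply] at h2
  rw [← h2]

/-- **`dim Ev[G, π, p] = dim End_G(V)` on the irreducible `(π, V)` met by the irreducible stable `P ∋ p`,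
`p ≠ 0`**: `S ↦ S(T₀ p)` is a linear isomorphism `End_G(V) ≅ Ev[G, π, p]` — onto because every equivariant
`T : ℚ^X → V` restricts on `P ≅ V` to an element of `End_G(V)`, injective because an intertwiner killing
`T₀ p` kills `T₀(𝒪[G, p]) = T₀(P) = V` (Schur; over `ℚ` the commutant `End_G(V)` is a division algebra of
dimension `δ ≥ 1`, not necessarily `ℚ`). [cite: Serre1977, §2.2 Prop. 4] [cite: Mai1989, §2 Prop. 1 (proof)] -/
theorem finrank_evalSpace_eq_of_irreducible [FiniteDimensional ℚ V] {P : Submodule ℚ (X → ℚ)}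
    (hPst : ∀ (k : G) (a : X → ℚ), a ∈ P → (fun x => a (k • x)) ∈ P)
    (hirr : ∀ W : Submodule ℚ (X → ℚ), W ≤ P → W ≠ ⊥ →
      (∀ (k : G) (f : X → ℚ), f ∈ W → (fun y => f (k • y)) ∈ W) → W = P)
    (π : Representation ℚ G V) (hπ : π.IsIrreducible)
    (T₀ : (X → ℚ) →ₗ[ℚ] V) (hT₀ : ∀ (g : G) (f : X → ℚ), T₀ (fun x => f (g⁻¹ • x)) = π g (T₀ f))
    (hT₀P : ¬ ∀ a ∈ P, T₀ a = 0) {p : X → ℚ} (hp : p ∈ P) (hp0 : p ≠ 0) :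
    Module.finrank ℚ Ev[G, π, p] = Module.finrank ℚ (π.IntertwiningMap π) := by
  obtain ⟨e, he, hesymm⟩ := exists_linearEquiv_of_irreducible hPst hirr π hπ T₀ hT₀ hT₀P
  have hOp : 𝒪[G, p] = P := orbitSpan_eq_of_irreducible hPst hirr hp hp0
  -- the evaluation map `Θ : End_G(V) → V`, `S ↦ S (T₀ p)`
  let Θ : π.IntertwiningMap π →ₗ[ℚ] V :=
    { toFun := fun S => S (T₀ p)
      map_add' := fun S S' => rfl
      map_smul' := fun c S => rfl }
  have hΘ : ∀ S, Θ S = S (T₀ p) := fun S => rfl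
  -- its range is the evaluation space
  have hrange : LinearMap.range Θ = Ev[G, π, p] := by
    apply le_antisymm
    · rintro _ ⟨S, rfl⟩
      rw [hΘ]
      refine Submodule.subset_span ⟨S.toLinearMap ∘ₗ T₀, fun g f => ?_, rfl⟩
      rw [LinearMap.comp_apply, LinearMap.comp_apply, hT₀]
      have h := S.isIntertwining _ _ g (T₀ f)
      exact h
    · rw [evalSpace_le_iff]
      intro T hT
      -- `S = T|_P ∘ e⁻¹`
      let S₀ : V →ₗ[ℚ] V := T ∘ₗ P.subtype ∘ₗ e.symm.toLinearMap
      have hS₀ : ∀ (g : G) (v : V), S₀ (π g v) = π g (S₀ v) := fun g v => by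
        simp only [S₀, LinearMap.comp_apply, LinearEquiv.coe_coe, Submodule.coe_subtype, hesymm, hT]
      refine ⟨S₀.intertwiningMap_of_isIntertwiningMap π π hS₀, ?_⟩
      rw [hΘ]
      change S₀ (T₀ p) = T p
      have h1 : e.symm (T₀ p) = ⟨p, hp⟩ := by
        rw [← he ⟨p, hp⟩, LinearEquiv.symm_apply_apply]
      simp only [S₀, LinearMap.comp_apply, LinearEquiv.coe_coe, h1, Submodule.coe_subtype]
  -- it is injective
  have hinj : Function.Injective Θ := by
    rw [← LinearMap.ker_eq_bot, LinearMap.ker_eq_bot']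
    intro S hS
    rw [hΘ] at hS
    -- `S ∘ T₀` is equivariant and kills `p`, hence `P`
    have hST : ∀ (g : G) (f : X → ℚ), (S.toLinearMap ∘ₗ T₀) (fun x => f (g⁻¹ • x)) =
        π g ((S.toLinearMap ∘ₗ T₀) f) := fun g f => by
      rw [LinearMap.comp_apply, LinearMap.comp_apply, hT₀]
      have h := S.isIntertwining _ _ g (T₀ f)
      exact h
    have hkill : ∀ a ∈ P, S (T₀ a) = 0 := fun a ha =>
      apply_eq_zero_of_mem_orbitSpan π (S.toLinearMap ∘ₗ T₀) hST (w := p) hS (hOp.symm ▸ ha)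
    apply Representation.IntertwiningMap.ext
    apply LinearMap.ext
    intro v
    have hv : S (T₀ (e.symm v : P)) = 0 := hkill _ (e.symm v).2
    rw [← he, LinearEquiv.apply_symm_apply] at hv
    simpa using hv
  rw [← hrange]
  exact LinearMap.finrank_range_of_inj hinj

/-- **`Ev[G, π', p] = 0` for every representation `π'` without non-zero intertwiner from `π`** (`π` the irreducible
type of the irreducible stable `P ∋ p`): an equivariant `T : ℚ^X → V'` restricts on `P ≅ V` to an intertwiner
`V → V'`. [cite: Serre1977, §2.2 Prop. 4] -/
theorem evalSpace_eq_bot_of_forall_intertwiningMap_eq_zero {P : Submodule ℚ (X → ℚ)}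
    (hPst : ∀ (k : G) (a : X → ℚ), a ∈ P → (fun x => a (k • x)) ∈ P)
    (hirr : ∀ W : Submodule ℚ (X → ℚ), W ≤ P → W ≠ ⊥ →
      (∀ (k : G) (f : X → ℚ), f ∈ W → (fun y => f (k • y)) ∈ W) → W = P)
    (π : Representation ℚ G V) (hπ : π.IsIrreducible)
    (T₀ : (X → ℚ) →ₗ[ℚ] V) (hT₀ : ∀ (g : G) (f : X → ℚ), T₀ (fun x => f (g⁻¹ • x)) = π g (T₀ f))
    (hT₀P : ¬ ∀ a ∈ P, T₀ a = 0)
    {V' : Type*} [AddCommGroup V'] [Module ℚ V'] (π' : Representation ℚ G V')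
    (hzero : ∀ S : π.IntertwiningMap π', S = 0) {p : X → ℚ} (hp : p ∈ P) : Ev[G, π', p] = ⊥ := by
  obtain ⟨e, he, hesymm⟩ := exists_linearEquiv_of_irreducible hPst hirr π hπ T₀ hT₀ hT₀P
  rw [eq_bot_iff, evalSpace_le_iff]
  intro T hT
  let S₀ : V →ₗ[ℚ] V' := T ∘ₗ P.subtype ∘ₗ e.symm.toLinearMap
  have hS₀ : ∀ (g : G) (v : V), S₀ (π g v) = π' g (S₀ v) := fun g v => by
    simp only [S₀, LinearMap.comp_apply, LinearEquiv.coe_coe, Submodule.coe_subtype, hesymm, hT]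
  have hS := hzero (S₀.intertwiningMap_of_isIntertwiningMap π π' hS₀)
  have hSp : S₀ (T₀ p) = 0 := by
    have := congrArg (fun S : π.IntertwiningMap π' => S (T₀ p)) hS
    simpa using this
  have h1 : e.symm (T₀ p) = ⟨p, hp⟩ := by
    rw [← he ⟨p, hp⟩, LinearEquiv.symm_apply_apply]
  simp only [S₀, LinearMap.comp_apply, LinearEquiv.coe_coe, h1, Submodule.coe_subtype] at hSp
  rw [Submodule.mem_bot]
  exact hSp

end Irreducible

end Summit.HodgeConjecture.CorCM.IrrOdd

end
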